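import Summits.QuantumAdvantage.QuantumAdvantage.Theorems.CharDialTransferDialF
import Summits.QuantumAdvantage.QuantumAdvantage.Theorems.CharDialShearDialB
import HarnessLib

/-!
# TransferDial L — the FIRST RUNG of the leaf is a theorem: SLICE-FEW at degree `≤ p − 1` (kernel, from law 2½)

The leaf of the SliceDial carving is `SliceFewTwoOdd` (degree `≤ 2p − 3`: bounded row counts for every bipartition).  One notch down the
ladder it HOLDS: by the tree's law 2½ `ShearDial.lawAt_all` (every Boolean function of `𝔽_p`-degree `≤ p − 1`, `p` odd, is a junta of
`≤ J₀(p)` coordinates ⊕ ONE linear form, `IslandDial.NormalForm`), the rows of any bipartition `(S, Sᶜ)` are indexed by the pair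
(junta bits inside `S`, the `S`-part of the form) — so `rowCount f S ≤ 2^{J₀(p)} · p` for every `S` (`rowCount_le_of_normalForm`,
`sliceFewAt_one`, ★ `sliceFewOneOdd_holds`).  This is the rung-0 analogue of piece S, in the regime where the structure law is known;
the leaf itself (degree `2p − 3`) stays OPEN.

Tree twin, part L of the decomp-qadv lens-6 g23 addendum.  0 sorry; no `instance`, no `notation`, no `native_decide`.
-/

set_option autoImplicit false
set_option linter.dupNamespace false

namespace Summit.QuantumAdvantage.QuantumAdvantage.Theorems.TransferDial

open Classical
open Finset
open Summit.QuantumAdvantage.AdviceFreeQNC0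
open Summit.QuantumAdvantage.QuantumAdvantage.Theorems.IslandDial (NormalForm)

section One
variable {p : ℕ} [Fact p.Prime]

/-- Rows of a junta-⊕-one-form function are indexed by (junta bits inside `S`, `S`-part of the form): `rowCount ≤ 2^{J₀} · p`. -/
theorem rowCount_le_of_normalForm {n J₀ : ℕ} (f : (Fin n → Bool) → Bool) (hf : NormalForm p f J₀) (S : Finset (Fin n)) :
    rowCount f S ≤ 2 ^ J₀ * p := by
  obtain ⟨J, hJ, a, h, hh, hfh⟩ := hf
  -- the index of a row and the row it determines
  let idx : (Fin n → Bool) → Finset (Fin n) × ZMod p :=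
    fun b => ((S ∩ J).filter fun i => b i = true, ∑ i, if i ∈ S ∧ b i = true then a i else 0)
  let g : Finset (Fin n) × ZMod p → ((Fin n → Bool) → Bool) :=
    fun q u => h (fun i => if i ∈ S then decide (i ∈ q.1) else u i) (q.2 + ∑ i, if i ∉ S ∧ u i = true then a i else 0)
  have hrow : ∀ b, rowOf f S b = g (idx b) := by
    intro b
    funext u
    show f _ = h _ _
    rw [hfh]
    have hagree : ∀ i ∈ J, (fun i => if i ∈ S then b i else u i) i =
        (fun i => if i ∈ S then decide (i ∈ (S ∩ J).filter fun i => b i = true) else u i) i := by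
      intro i hiJ
      by_cases hi : i ∈ S
      · simp [hi, hiJ, mem_filter, mem_inter]
      · simp [hi]
    rw [hh _ _ hagree]
    congr 1
    show (∑ i, if (if i ∈ S then b i else u i) = true then a i else 0) =
      (∑ i, if i ∈ S ∧ b i = true then a i else 0) + ∑ i, if i ∉ S ∧ u i = true then a i else 0
    rw [← sum_add_distrib]
    refine sum_congr rfl fun i _ => ?_
    by_cases hi : i ∈ S
    · by_cases hb : b i = true <;> simp [hi, hb]
    · by_cases hu : u i = true <;> simp [hi, hu]
  have himg : (univ : Finset (Fin n → Bool)).image (rowOf f S) = ((univ : Finset (Fin n → Bool)).image idx).image g := by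
    rw [image_image]
    exact image_congr fun b _ => hrow b
  have hsub : (univ : Finset (Fin n → Bool)).image idx ⊆ (S ∩ J).powerset ×ˢ (univ : Finset (ZMod p)) := by
    intro q hq
    rw [mem_image] at hq
    obtain ⟨b, -, rfl⟩ := hq
    rw [mem_product, mem_powerset]
    exact ⟨filter_subset _ _, mem_univ _⟩
  have hSJ : (S ∩ J).card ≤ J₀ := (card_le_card inter_subset_right).trans hJ
  calc rowCount f S = (((univ : Finset (Fin n → Bool)).image idx).image g).card := by rw [rowCount, himg]
    _ ≤ ((univ : Finset (Fin n → Bool)).image idx).card := card_image_le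
    _ ≤ ((S ∩ J).powerset ×ˢ (univ : Finset (ZMod p))).card := card_le_card hsub
    _ = 2 ^ (S ∩ J).card * p := by rw [card_product, card_powerset, card_univ, ZMod.card]
    _ ≤ 2 ^ J₀ * p := Nat.mul_le_mul_right _ (Nat.pow_le_pow_right (by norm_num) hSJ)

/-- ★ SLICE-FEW AT DEGREE `≤ p − 1`, every odd prime: `SliceFewAt p (p − 1) (2^{J₀(p)} · p)` (law 2½ `ShearDial.lawAt_all`). -/
theorem sliceFewAt_one (p : ℕ) [Fact p.Prime] (hp2 : p ≠ 2) : ∃ R : ℕ, SliceFewAt p (p - 1) R := by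
  obtain ⟨J₀, hJ₀⟩ := Summit.QuantumAdvantage.QuantumAdvantage.Theorems.ShearDial.lawAt_all p hp2
  exact ⟨2 ^ J₀ * p, fun n f hf S => rowCount_le_of_normalForm f (hJ₀ n f hf) S⟩

end One

/-- The degree-`(p − 1)` rung of the leaf `SliceFewTwoOdd` (same shape, degree `p − 1` in place of `2p − 3`). -/
def SliceFewOneOdd : Prop := ∀ (p : ℕ) [Fact p.Prime], 5 ≤ p → ∃ R : ℕ, SliceFewAt p (p - 1) R

/-- ★ The rung HOLDS (kernel). -/
theorem sliceFewOneOdd_holds : SliceFewOneOdd := fun p _ hp => sliceFewAt_one p (by omega)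

/-- info: 'Summit.QuantumAdvantage.QuantumAdvantage.Theorems.TransferDial.sliceFewOneOdd_holds' depends on axioms: [propext,
 choice,
 Quot.sound] -/
#guard_msgs in #print axioms sliceFewOneOdd_holds

end Summit.QuantumAdvantage.QuantumAdvantage.Theorems.TransferDial
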